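/-
Copyright: lit-balaban Phase-2 proof seat p30 (gen 5).  Statement-level skeleton of a published paper; no proof claims beyond what
the kernel checks below.
-/
import Literature.MathematicalPhysics.QuantumFieldTheory.BalabanImbrieJaffe1984to88.BIJ85Eq611Structural
import Literature.MathematicalPhysics.QuantumFieldTheory.BalabanImbrieJaffe1984to88.BIJ85Prop521Torus
import Literature.MathematicalPhysics.QuantumFieldTheory.BalabanImbrieJaffe1984to88.BIJ85Sigma421Torus
import Literature.MathematicalPhysics.QuantumFieldTheory.BalabanImbrieJaffe1984to88.BIJ85NoZeroModes309Torus
import Literature.MathematicalPhysics.QuantumFieldTheory.BalabanImbrieJaffe1984to88.BIJ85SigmaTorusScaling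

/-!
# `BalabanImbrieJaffe1984to88.BIJ85Eq611Torus` — T. Bałaban, J. Imbrie, A. Jaffe, *Renormalization of the Higgs model: minimizers,
propagators and the stability of mean field theory*, Commun. Math. Phys. **97** (1985) 299–329 [BalabanImbrieJaffe1985]: Sect. 6.1
**(6.1.1) σ_k = σ_{k+1} + Fluctuation Form ON THE TORI of the series** — every printed input of the derivation (6.1.2)–(6.1.9) is a
theorem of the tree's torus calculus, so (6.1.1) holds for the torus σ_k of (4.2.1)–(4.2.2) (`BIJ85Sigma421Torus.sigmaTorus`) with no
hypothesis beyond the standing range `k + 1 ≤ m + K`, `c ≠ 0`, `w = η^d > 0`, `2 ≤ d`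

statement-level skeleton of published theorems with citation tags; proofs where landed; nothing here is a claim about the Yang–Mills mass gap

PDF held: `paper:balaban1985-cmp97-bij-higgs-minimizers` (journal page = PDF page + 298).  Pages read as images: pp. 318–319
[PDF 20–21] (`HOME/lit-balaban-r15/pages/1985-cmp97-bij-higgs-minimizers-p020-x2.png`, `…-p021-x2.png`), pp. 305, 310–311, 316.

CITATION HEADER (lean-in-tree rule).  Part of the lit-balaban TYPED SKELETON (HOME `run/shared/lean/pub/lit-balaban/`), Phase-2
seat p30 (gen 5), unit `lit-balaban-p30`; WHAT IS REPRODUCED = rows **C1.Eq6.1.1** and **C1.Eq6.1.2-6.1.9** of `HOME/SKELETON.md`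
(reader file `HOME/lit-balaban-r15/ROWS-C1.md`) AT THE TORUS MODEL OF RECORD — the instance of `BIJ85Eq611Structural.eq611_structural`
(which discharges the operator-algebra inputs of gen 1's `BIJ85Eq611Proof.eq611`) at seat p09's torus data.

THE PRINTED CLAIM (p. 318 [PDF 20], verbatim): *"The goal here is to show that ⟨f^{(k)}, σ_k f^{(k)}⟩ = 𝒮_L^{−1}⟨f^{(k+1)}, σ_{k+1}
f^{(k+1)}⟩ + ⟨B, Δ_kB⟩. (6.1.1) In other words, the quadratic form σ_k in S_k which occurs in the integrand (6.1) can be decomposed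
into the sum of two independent forms: the (k+1)-step quadratic form scaled to the L-lattice and the quadratic form for the fluctuation
field B."* with (6.4) *"f^{(k)}(p) = (∂B′)(p) + L^{−d/2}(Q^{e*}f^{(k+1)})(p)"*, (6.1.8) *"B′ = B − L^{−d/2}C^{(k)}H_k^*∂^*Q^{e*}_{k+1}f^{(k+1)}"*
and p. 319 *"where the scaling 𝒮_L absorbs the factor L^{−d} and where σ_{k+1} = Q^e_{k+1}(I − ∂G_{k+1,Ax}∂^*)Q^{e*}_{k+1}"*.

THE TORUS DATA (tori `…Balaban1983to89.Setup`, `Site P j`; fine lattice `T^{(0)} = T_η`, unit lattice of the k-th step `T^{(k)}`,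
L-lattice `T^{(k+1)}`): η-bond fields `E = BondSpace P` and η-plaquette fields `F = PlaqSpace P` (seat p09), `∂ = curlOp w c = √w·∂_c`
(`w = η^d`), constraint subspaces `V411 P (k+1)` ⊇ `V411 P k` = δ(Q_jA)δ_{j,Ax}(A), unit bond fields `CoarseSpace P k` with `Q_k = QcE P k`,
`Q^{s*}_k = QsE P k` and the fluctuation constraint `Wstep P k` = δ(QB′)δ_{Ax}(B′) (seat p30 gen 3 `BIJ85Prop521Torus`), unit plaquette
fields `UnitPlaqSpace P k` with `Q^{e*}_k = QesOp hd w k = √w·(Q^{e*})^k` and `σ_k = sigmaTorus hd w c k` (`BIJ85Sigma421Torus`).  NEW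
here (defs with bodies): the unit-lattice curl `dOne P k c` (= ∂ on `T^{(k)}`, factor `c/L^k`) and the one-step `Q^{e*}` from `T^{(k+1)}`-
to `T^{(k)}`-plaquette fields `QesOne P hd k` ((2.22), `BIJ85CurlQsstar.torusEdgeCells`).  THE FOUR NAMED INPUTS of
`BIJ85Eq611Structural` ARE THEOREMS HERE: no zero modes at level k+1 = seat p33's `BIJ85NoZeroModes309Torus.hD_holds` (p. 309 claim,
every k); the constraint tower `Q_kQ^{s*}_k = I` / `δ(Q_{k+1}A)δ_{k+1,Ax}(A) = ∫𝒟Bδ(QB)δ(Q_kA − B)δ_{Ax}(B)δ_{k,Ax}(A)` =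
`BIJ85Prop521Torus.QcE_QsE`/`QcE_eq_zero_of_mem`/`factor_V411`; `∂Q^{s*}_k = Q^{e*}_k∂` = `BIJ85Sigma421Torus.QesOp_curl_eq` (`curlOp_QsE`);
`Q^{e*}_kQ^{e*} = Q^{e*}_{k+1}` = `BIJ85Eq531Inputs.QestarIter_succ` (`QesOp_QesOne`).  (6.1.4) ∂H_k = ∂H_{k,Ax} stays the hypothesis of
the general-H_k form and is `rfl` for H_k := H_{k,Ax} (`eq611_torus_ax`).

WHAT IS PROVED: `curlOp_QsE`, `QesOp_QesOne`, `sigmaOp_succ_eq_sigmaTorus` (σ_{k+1} of p. 319 IS the torus σ_{k+1} of (4.2.2) one level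
up), `Hop_torus_mem`/`inner_deltaOp_torus` (⟨B, Δ_kB⟩ of the operator Δ_k = p30 gen 3's `deltaTorus`, (4.3.1)), **`eq611_torus`** ((6.1.1)
on the tori for any linear H_k with (6.1.4)), **`eq611_torus_ax`** (H_k := H_{k,Ax}: hypothesis-free), `eq611_torus_L` (the factor written
`L^{−d}`, l = L^{−d/2}).  Scaling remark: as in gen 1's `eq611`, both forms are written in the SAME η-lattice (before the rescaling 𝒮_L of
(3.2)); *"the scaling 𝒮_L absorbs the factor L^{−d}"*.  D-0026: no new named fact; the three `def`s are printed objects with bodies.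
Unit `lit-balaban-p30` (literature-prover-lit-balaban-p30-g5-0), 2026-08-21.

**v1.1 (append-only, same seat):** §5 — (6.1.1) IN THE PRINTED FORM, the right member read in the (k+1)-st step's own normalization:
`⟨f^{(k)}, σ_k^{(w)}f^{(k)}⟩ = ⟨f^{(k+1)}, σ_{k+1}^{(L^{−d}w)}f^{(k+1)}⟩ + ⟨B, Δ_kB⟩` (`eq611_torus_rescaled`, `eq611_torus_rescaled_L`), by the
𝒮_L bookkeeping `BIJ85SigmaTorusScaling.scaling_absorbs` (the torus σ is linear in the weight `w = η^d` and independent of the curl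
factor); new import `BIJ85SigmaTorusScaling`; v1.0 text unchanged except that the one-line transport lemma `noZeroModes_V411_torus`
(= p09's `noZeroModes_V411` at p33's `hD_holds`; meanwhile landed verbatim as seat p11's `BIJ85Prop522Torus.hD_V411`) is inlined at its
single use (dedup).
-/

open scoped BigOperators RealInnerProductSpace

namespace Literature.MathematicalPhysics.QuantumFieldTheory.BalabanImbrieJaffe1984to88.BIJ85Eq611Torus

open Literature.MathematicalPhysics.QuantumFieldTheory.Balaban1983to89
open LatticeFieldCalculus BIJ85CellAverages BIJ85Eq219Proof BIJ85CurlQsstar BIJ85Eq531Inputs BIJ85AxialPropagator411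
  BIJ85AxialMinimizer413 BIJ85SigmaForm421 BIJ85UnitPropagator433 BIJ85Prop521Proof BIJ85Prop521Torus BIJ85Sigma421Torus
  BIJ85NoZeroModes309Torus BIJ85Eq611Structural

noncomputable section

variable {P : Params}

/-! ## 1. The unit-lattice curl and the one-step `Q^{e*}` as linear maps between the Euclidean spaces -/

/-- The curl `∂_{c′}` of `T^{(k)}` bond fields as a linear map ([Balaban1984PropagatorsI] (1.2); BIJ (2.1) conventions).
[cite: BalabanImbrieJaffe1985, (2.1) p.304] -/
def curlLinK (k : ℕ) (c' : ℝ) : (PBond P k → ℝ) →ₗ[ℝ] (Plaq P k → ℝ) where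
  toFun B := fun p => curl c' B p
  map_add' A B := by
    funext p
    exact curl_add c' A B p
  map_smul' r A := by
    funext p
    simp only [curl, Pi.smul_apply, smul_eq_mul, RingHom.id_apply]
    ring

/-- **`∂` on the unit lattice `T^{(k)}`** — the `∂B′` of (6.4) *"f^{(k)}(p) = (∂B′)(p) + L^{−d/2}(Q^{e*}f^{(k+1)})(p)"* — between the
Euclidean spaces `CoarseSpace P k` (unit bond fields) and `UnitPlaqSpace P k`; factor `c/L^k` against the fine-lattice factor `c` of
`curlOp w c` (so that `∂Q^{s*}_k = Q^{e*}_k∂`, `curlOp_QsE`). [cite: BalabanImbrieJaffe1985, (6.4) p.318] -/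
def dOne (P : Params) (k : ℕ) (c : ℝ) : CoarseSpace P k →ₗ[ℝ] UnitPlaqSpace P k :=
  (toU P k).toLinearMap ∘ₗ curlLinK (P := P) k (c / (P.L : ℝ) ^ k) ∘ₗ (toEj P k).symm.toLinearMap

/-- The one-step edge pull-back (2.22) as a linear map on plaquette FIELDS. [cite: BalabanImbrieJaffe1985, (2.22) p.305] -/
def qstarLin (P : Params) (hd : 2 ≤ P.d) (k : ℕ) : (Plaq P (k + 1) → ℝ) →ₗ[ℝ] (Plaq P k → ℝ) where
  toFun := (torusEdgeCells P k hd).Qstar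
  map_add' := cellsQstar_add (torusEdgeCells P k hd)
  map_smul' a g := by
    rw [RingHom.id_apply]
    exact cellsQstar_smul (torusEdgeCells P k hd) a g

/-- **`Q^{e*}` (one step)** from the `T^{(k+1)}`- (L-lattice) to the `T^{(k)}`- (unit-lattice) plaquette fields — the `Q^{e*}` of (6.4),
verbatim (2.22): *"(Q^{e*}f)(p) = L²f(p′), if p ∈ B^e(p′), 0, otherwise"* (`BIJ85CurlQsstar.torusEdgeCells`), between the Euclidean
spaces. [cite: BalabanImbrieJaffe1985, (2.22) p.305] -/
def QesOne (P : Params) (hd : 2 ≤ P.d) (k : ℕ) : UnitPlaqSpace P (k + 1) →ₗ[ℝ] UnitPlaqSpace P k :=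
  (toU P k).toLinearMap ∘ₗ qstarLin P hd k ∘ₗ (toU P (k + 1)).symm.toLinearMap

/-- Components are unchanged by `toU`. [folklore] -/
@[simp] private theorem toU_apply' (k : ℕ) (f : Plaq P k → ℝ) (p : Plaq P k) : toU P k f p = f p := rfl

/-- Components are unchanged by `toU⁻¹`. [folklore] -/
@[simp] private theorem toU_symm_apply' (k : ℕ) (f : UnitPlaqSpace P k) (p : Plaq P k) : (toU P k).symm f p = f p := rfl

/-- Components of `dOne`: `(∂B′)(p) = curl_{c/L^k} B′ p`. [cite: BalabanImbrieJaffe1985, (6.4) p.318] -/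
theorem dOne_apply (k : ℕ) (c : ℝ) (B : CoarseSpace P k) (p : Plaq P k) :
    dOne P k c B p = curl (c / (P.L : ℝ) ^ k) (fun b => B b) p := rfl

/-- `dOne` on a bond FUNCTION: `dOne (ι B) = ι (curl B)`. [cite: BalabanImbrieJaffe1985, (6.4) p.318] -/
theorem dOne_toEj (k : ℕ) (c : ℝ) (B : PBond P k → ℝ) :
    dOne P k c (toEj P k B) = toU P k (curl (c / (P.L : ℝ) ^ k) B) := rfl

/-- Components of `QesOne`: `(Q^{e*}f)(p)` = the cell pull-back (2.22). [cite: BalabanImbrieJaffe1985, (2.22) p.305] -/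
theorem QesOne_apply (hd : 2 ≤ P.d) (k : ℕ) (f : UnitPlaqSpace P (k + 1)) (p : Plaq P k) :
    QesOne P hd k f p = (torusEdgeCells P k hd).Qstar (fun q => f q) p := rfl

/-! ## 2. The named inputs of `BIJ85Eq611Structural` are theorems on the tori -/

/-- **`∂Q^{s*}_k = Q^{e*}_k∂`** (p. 317 under (5.3.1), p. 319 (6.1.5), p. 323 (7.1.18)) as the operator identity `curlOp ∘ Q^{s*}_k =
Q^{e*}_k ∘ dOne` between the Euclidean spaces (seat p30 gen 3's `QesOp_curl_eq`, from seat p31's one-step `curl_Qsstar`); standing range.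
[cite: BalabanImbrieJaffe1985, (6.1.5) p.319] -/
theorem curlOp_QsE (hd : 2 ≤ P.d) {k : ℕ} (hk : k ≤ P.m + P.K) (w c : ℝ) :
    curlOp (P := P) w c ∘ₗ QsE P k = QesOp (P := P) hd w k ∘ₗ dOne P k c := by
  refine LinearMap.ext fun B => ?_
  rw [LinearMap.comp_apply, LinearMap.comp_apply, QsE_apply, ← QesOp_curl_eq hd hk w c ((toEj P k).symm B)]
  rfl

/-- **`Q^{e*}_kQ^{e*} = Q^{e*}_{k+1}`** — the adjoint form of *"note that Q^eQ^e_k = Q^e_{k+1}"* (p. 319), for the composites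
`QesOp` (`= √w·Q^{e*}_k`) and the one-step `QesOne` (`BIJ85Eq531Inputs.QestarIter_succ`). [cite: BalabanImbrieJaffe1985, (6.1.3) p.319] -/
theorem QesOp_QesOne (hd : 2 ≤ P.d) (w : ℝ) (k : ℕ) :
    QesOp (P := P) hd w k ∘ₗ QesOne P hd k = QesOp (P := P) hd w (k + 1) := by
  refine LinearMap.ext fun f => ?_
  ext p
  rw [LinearMap.comp_apply, QesOp_apply, QesOp_apply, QestarIter_succ]
  rfl

/-- Hence **σ_{k+1} of p. 319** (*"σ_{k+1} = Q^e_{k+1}(I − ∂G_{k+1,Ax}∂^*)Q^{e*}_{k+1}"*, with `Q^{e*}_{k+1} = Q^{e*}_kQ^{e*}`) IS the torus σ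
of (4.2.1)–(4.2.2) one level up, `sigmaTorus hd w c (k+1)`. [cite: BalabanImbrieJaffe1985, (6.1.1) p.319] -/
theorem sigmaOp_succ_eq_sigmaTorus (hd : 2 ≤ P.d) (w c : ℝ) (k : ℕ) :
    sigmaOp (V411 P (k + 1)) (curlOp (P := P) w c) (QesOp (P := P) hd w k ∘ₗ QesOne P hd k) = sigmaTorus (P := P) hd w c (k + 1) := by
  rw [QesOp_QesOne]; rfl

/-! ## 3. `⟨B, Δ_kB⟩` of the operator `Δ_k` is the torus action of (4.3.1) -/

/-- `H_{k,Ax}B` (p09's linear `Hop` at the torus data) is gen 1's Gaussian mean `torusHax` at the representative `Q^{s*}_kB`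
(`BIJ85Prop521Torus.Hop_torus` with its hypothesis supplied by p33). [cite: BalabanImbrieJaffe1985, (4.1.3) p.310] -/
theorem Hop_torus' {k : ℕ} (hk : k ≤ P.m + P.K) {c : ℝ} (hc : c ≠ 0) {w : ℝ} (hw : 0 < w) (B : CoarseSpace P k) :
    Hop (V411 P k) (curlOp (P := P) w c) (QsE P k) B = toE P (torusHax w c k (QsstarIter k ((toEj P k).symm B))) :=
  Hop_torus hw c (hD_holds hk hc) B

/-- **(4.3.1) on the torus, operator form = functional form**: `⟨B, Δ_kB⟩` for `Δ_k = (∂H_{k,Ax})^*(∂H_{k,Ax})` (`deltaOp` at the torus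
data) is seat p30 gen 3's `deltaTorus w c k B = Σ_pη^d|(∂H_{k,Ax}B)(p)|²` (the right member of (4.3.2)). [cite: BalabanImbrieJaffe1985, (4.3.1) p.311] -/
theorem inner_deltaOp_torus {k : ℕ} (hk : k ≤ P.m + P.K) {c : ℝ} (hc : c ≠ 0) {w : ℝ} (hw : 0 < w) (B : CoarseSpace P k) :
    ⟪B, deltaOp (V411 P k) (curlOp (P := P) w c) (QsE P k) B⟫ = deltaTorus w c k ((toEj P k).symm B) := by
  rw [inner_deltaOp, Hop_torus' hk hc hw, deltaTorus]
  have h := half_norm_curlOp_sq hw.le c (toE P (torusHax w c k (QsstarIter k ((toEj P k).symm B))))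
  rw [LinearEquiv.symm_apply_apply] at h
  linarith

/-- The fluctuation constraint `ℋ₀ = δ(QB′)δ_{Ax}(B′)` of p. 319 on the torus is `Wstep`: `QB′ = 0` (one-step block average) and the
one-step axial gauge. [cite: BalabanImbrieJaffe1985, (6.1.7) p.319] -/
theorem mem_Wstep_iff (k : ℕ) (B' : CoarseSpace P k) :
    B' ∈ Wstep P k ↔ bondAvg ((toEj P k).symm B') = 0 ∧ IsAxial ((toEj P k).symm B') :=
  mem_Wstep k B'

/-! ## 4. (6.1.1) on the tori -/

/-- **(6.1.1) ON THE TORI** p. 318 [PDF 20], verbatim: *"⟨f^{(k)}, σ_k f^{(k)}⟩ = 𝒮_L^{−1}⟨f^{(k+1)}, σ_{k+1} f^{(k+1)}⟩ + ⟨B, Δ_kB⟩.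
(6.1.1)"* — for the torus forms σ_k = `sigmaTorus hd w c k`, σ_{k+1} = `sigmaTorus hd w c (k+1)` ((4.2.1)–(4.2.2) at the two levels, same
η-lattice, 𝒮_L^{−1}⟨·,·⟩ = l²⟨·,·⟩ with l = L^{−d/2} as in gen 1), Δ_k = `deltaOp` and C^{(k)} = `unitPropagator` at the torus data,
f^{(k)} = ∂B′ + lQ^{e*}f^{(k+1)} ((6.4): `dOne`, `QesOne`), B′ in δ(QB′)δ_{Ax}(B′) = `Wstep P k`, B = B′ + lC^{(k)}H_k^*∂^*Q^{e*}_{k+1}f^{(k+1)}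
((6.1.8)) for ANY linear H_k obeying the gauge invariance statement (6.1.4) ∂H_k = ∂H_{k,Ax}.  Every other printed input is discharged:
(4.2.2), (4.3.1), (5.3.1), (5.2.1), Prop A3 (A15)–(A16) with C = C^{(k)} (`BIJ85Eq611Structural`), no zero modes (p33 `hD_holds`), the
constraint tower (`factor_V411`, `QcE_QsE`), ∂Q^{s*}_k = Q^{e*}_k∂ (`curlOp_QsE`), Q^{e*}_kQ^{e*} = Q^{e*}_{k+1} (`QesOp_QesOne`); standing
range `k + 1 ≤ m + K`, `c ≠ 0`, `w = η^d > 0`, `2 ≤ d`. [cite: BalabanImbrieJaffe1985, (6.1.1) p.318] -/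
theorem eq611_torus (hd : 2 ≤ P.d) {k : ℕ} (hk : k + 1 ≤ P.m + P.K) {c : ℝ} (hc : c ≠ 0) {w : ℝ} (hw : 0 < w)
    (Hk : CoarseSpace P k →ₗ[ℝ] BondSpace P)
    (h614 : curlOp (P := P) w c ∘ₗ Hk = curlOp (P := P) w c ∘ₗ Hop (V411 P k) (curlOp (P := P) w c) (QsE P k))
    (l : ℝ) (fL : UnitPlaqSpace P (k + 1)) (B' : CoarseSpace P k) (hB' : B' ∈ Wstep P k) :
    ⟪dOne P k c B' + l • QesOne P hd k fL, sigmaTorus (P := P) hd w c k (dOne P k c B' + l • QesOne P hd k fL)⟫ =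
      l ^ 2 * ⟪fL, sigmaTorus (P := P) hd w c (k + 1) fL⟫
      + ⟪B' + l • unitPropagator (V411 P k) (curlOp (P := P) w c) (QsE P k) (Wstep P k)
            (LinearMap.adjoint Hk (LinearMap.adjoint (curlOp (P := P) w c) (QesOp (P := P) hd w (k + 1) fL))),
         deltaOp (V411 P k) (curlOp (P := P) w c) (QsE P k)
           (B' + l • unitPropagator (V411 P k) (curlOp (P := P) w c) (QsE P k) (Wstep P k)
            (LinearMap.adjoint Hk (LinearMap.adjoint (curlOp (P := P) w c) (QesOp (P := P) hd w (k + 1) fL))))⟫ := by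
  have hk' : k ≤ P.m + P.K := by omega
  have h := eq611_structural (V := V411 P (k + 1)) (V' := V411 P k) (W := Wstep P k) (D := curlOp (P := P) w c)
    (Qc := QcE P k) (Qs := QsE P k) (noZeroModes_V411 hw c (k + 1) (hD_holds hk hc)) (QcE_QsE hk')
    (fun v => QcE_eq_zero_of_mem v.2)
    (factor_V411 hk') (QesOp (P := P) hd w k) (QesOne P hd k) (dOne P k c) (curlOp_QsE hd hk' w c) Hk h614 l fL B' hB'
  have hQ : QesOp (P := P) hd w k (QesOne P hd k fL) = QesOp (P := P) hd w (k + 1) fL := by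
    rw [← QesOp_QesOne hd w k]; rfl
  rw [sigmaOp_succ_eq_sigmaTorus, hQ] at h
  exact h

/-- **(6.1.1) ON THE TORI with H_k := H_{k,Ax}** (`Hop` at the torus data = gen 1's `torusHax ∘ Q^{s*}_k`, `Hop_torus'`): (6.1.4) is
`rfl`, so NOTHING of Sect. 6.1 is left as a hypothesis; by (5.2.8) (`BIJ85Eq611Structural.transl_eq_of_614`) the translation (6.1.8) is
the same vector for every H_k with ∂H_k = ∂H_{k,Ax}. [cite: BalabanImbrieJaffe1985, (6.1.1) p.318] -/
theorem eq611_torus_ax (hd : 2 ≤ P.d) {k : ℕ} (hk : k + 1 ≤ P.m + P.K) {c : ℝ} (hc : c ≠ 0) {w : ℝ} (hw : 0 < w)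
    (l : ℝ) (fL : UnitPlaqSpace P (k + 1)) (B' : CoarseSpace P k) (hB' : B' ∈ Wstep P k) :
    ⟪dOne P k c B' + l • QesOne P hd k fL, sigmaTorus (P := P) hd w c k (dOne P k c B' + l • QesOne P hd k fL)⟫ =
      l ^ 2 * ⟪fL, sigmaTorus (P := P) hd w c (k + 1) fL⟫
      + ⟪B' + l • unitPropagator (V411 P k) (curlOp (P := P) w c) (QsE P k) (Wstep P k)
            (LinearMap.adjoint (Hop (V411 P k) (curlOp (P := P) w c) (QsE P k))
              (LinearMap.adjoint (curlOp (P := P) w c) (QesOp (P := P) hd w (k + 1) fL))),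
         deltaOp (V411 P k) (curlOp (P := P) w c) (QsE P k)
           (B' + l • unitPropagator (V411 P k) (curlOp (P := P) w c) (QsE P k) (Wstep P k)
            (LinearMap.adjoint (Hop (V411 P k) (curlOp (P := P) w c) (QsE P k))
              (LinearMap.adjoint (curlOp (P := P) w c) (QesOp (P := P) hd w (k + 1) fL))))⟫ :=
  eq611_torus hd hk hc hw _ rfl l fL B' hB'

/-- **(6.1.1) ON THE TORI with the factor written `L^{−d}`** (p. 319: *"the scaling 𝒮_L absorbs the factor L^{−d}"*): `l = L^{−d/2} =
(√L)^{−d}`, `l² = L^{−d}`, H_k := H_{k,Ax}. [cite: BalabanImbrieJaffe1985, (6.1.1) p.318] -/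
theorem eq611_torus_L (hd : 2 ≤ P.d) {k : ℕ} (hk : k + 1 ≤ P.m + P.K) {c : ℝ} (hc : c ≠ 0) {w : ℝ} (hw : 0 < w)
    (fL : UnitPlaqSpace P (k + 1)) (B' : CoarseSpace P k) (hB' : B' ∈ Wstep P k) :
    let l : ℝ := (Real.sqrt (P.L : ℝ))⁻¹ ^ P.d
    ⟪dOne P k c B' + l • QesOne P hd k fL, sigmaTorus (P := P) hd w c k (dOne P k c B' + l • QesOne P hd k fL)⟫ =
      ((P.L : ℝ) ^ P.d)⁻¹ * ⟪fL, sigmaTorus (P := P) hd w c (k + 1) fL⟫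
      + ⟪B' + l • unitPropagator (V411 P k) (curlOp (P := P) w c) (QsE P k) (Wstep P k)
            (LinearMap.adjoint (Hop (V411 P k) (curlOp (P := P) w c) (QsE P k))
              (LinearMap.adjoint (curlOp (P := P) w c) (QesOp (P := P) hd w (k + 1) fL))),
         deltaOp (V411 P k) (curlOp (P := P) w c) (QsE P k)
           (B' + l • unitPropagator (V411 P k) (curlOp (P := P) w c) (QsE P k) (Wstep P k)
            (LinearMap.adjoint (Hop (V411 P k) (curlOp (P := P) w c) (QsE P k))
              (LinearMap.adjoint (curlOp (P := P) w c) (QesOp (P := P) hd w (k + 1) fL))))⟫ := by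
  intro l
  have hL : (0 : ℝ) < (P.L : ℝ) := by have := P.hL.2; positivity
  have hl : l ^ 2 = ((P.L : ℝ) ^ P.d)⁻¹ := by
    show ((Real.sqrt (P.L : ℝ))⁻¹ ^ P.d) ^ 2 = _
    rw [← pow_mul, mul_comm, pow_mul, inv_pow, Real.sq_sqrt hL.le, inv_pow]
  rw [← hl]
  exact eq611_torus_ax hd hk hc hw l fL B' hB'

/-- **The two "independent forms" of p. 318 are genuinely torus quantities**: in (6.1.1) the fluctuation term is p30 gen 3's action
`⟨B, Δ_kB⟩ = deltaTorus w c k B = Σ_pη^d|(∂H_{k,Ax}B)(p)|²` ((4.3.1)–(4.3.2)) of the translated fluctuation field.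
[cite: BalabanImbrieJaffe1985, (6.1.1) p.318] -/
theorem eq611_torus_deltaTorus (hd : 2 ≤ P.d) {k : ℕ} (hk : k + 1 ≤ P.m + P.K) {c : ℝ} (hc : c ≠ 0) {w : ℝ} (hw : 0 < w)
    (l : ℝ) (fL : UnitPlaqSpace P (k + 1)) (B' : CoarseSpace P k) (hB' : B' ∈ Wstep P k) :
    ⟪dOne P k c B' + l • QesOne P hd k fL, sigmaTorus (P := P) hd w c k (dOne P k c B' + l • QesOne P hd k fL)⟫ =
      l ^ 2 * ⟪fL, sigmaTorus (P := P) hd w c (k + 1) fL⟫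
      + deltaTorus w c k ((toEj P k).symm
          (B' + l • unitPropagator (V411 P k) (curlOp (P := P) w c) (QsE P k) (Wstep P k)
            (LinearMap.adjoint (Hop (V411 P k) (curlOp (P := P) w c) (QsE P k))
              (LinearMap.adjoint (curlOp (P := P) w c) (QesOp (P := P) hd w (k + 1) fL))))) := by
  rw [← inner_deltaOp_torus (by omega) hc hw]
  exact eq611_torus_ax hd hk hc hw l fL B' hB'

end

end Literature.MathematicalPhysics.QuantumFieldTheory.BalabanImbrieJaffe1984to88.BIJ85Eq611Torus

/-! ## 5. (6.1.1) read after the rescaling `𝒮_L` (v1.1) -/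

namespace Literature.MathematicalPhysics.QuantumFieldTheory.BalabanImbrieJaffe1984to88.BIJ85Eq611Torus

open Literature.MathematicalPhysics.QuantumFieldTheory.Balaban1983to89
open LatticeFieldCalculus BIJ85AxialPropagator411 BIJ85SigmaForm421 BIJ85UnitPropagator433 BIJ85Prop521Torus BIJ85Sigma421Torus
  BIJ85SigmaTorusScaling

noncomputable section

variable {P : Params}

/-- **(6.1.1) IN THE PRINTED FORM, ON THE TORI** p. 318–319: *"⟨f^{(k)}, σ_k f^{(k)}⟩ = 𝒮_L^{−1}⟨f^{(k+1)}, σ_{k+1} f^{(k+1)}⟩ + ⟨B, Δ_kB⟩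
… where the scaling 𝒮_L absorbs the factor L^{−d}"* — the right member READ IN THE (k+1)-ST STEP'S OWN NORMALIZATION: with the k-th step
weight `w = η^d` and `l² = L^{−d}`, `l²·⟨f, σ_{k+1}f⟩_w = ⟨f, σ_{k+1}f⟩_{l²w}` (`BIJ85SigmaTorusScaling.scaling_absorbs`, `l²w = (η/L)^d`; the
torus σ is independent of the curl factor, so any `c′ ≠ 0` may be used at level k+1), hence
`⟨f^{(k)}, σ_k^{(w,c)}f^{(k)}⟩ = ⟨f^{(k+1)}, σ_{k+1}^{(l²w,c′)}f^{(k+1)}⟩ + ⟨B, Δ_kB⟩` for f^{(k)} = ∂B′ + lQ^{e*}f^{(k+1)}, B′ ∈ δ(QB′)δ_{Ax}(B′),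
B = (6.1.8) with H_k := H_{k,Ax}; hypothesis-free (k+1 ≤ m+K, c, c′, l ≠ 0, w > 0, 2 ≤ d). [cite: BalabanImbrieJaffe1985, (6.1.1) p.318] -/
theorem eq611_torus_rescaled (hd : 2 ≤ P.d) {k : ℕ} (hk : k + 1 ≤ P.m + P.K) {c c' : ℝ} (hc : c ≠ 0) (hc' : c' ≠ 0) {w : ℝ}
    (hw : 0 < w) {l : ℝ} (hl : l ≠ 0) (fL : UnitPlaqSpace P (k + 1)) (B' : CoarseSpace P k) (hB' : B' ∈ Wstep P k) :
    ⟪dOne P k c B' + l • QesOne P hd k fL, sigmaTorus (P := P) hd w c k (dOne P k c B' + l • QesOne P hd k fL)⟫ =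
      ⟪fL, sigmaTorus (P := P) hd (l ^ 2 * w) c' (k + 1) fL⟫
      + ⟪B' + l • unitPropagator (V411 P k) (curlOp (P := P) w c) (QsE P k) (Wstep P k)
            (LinearMap.adjoint (Hop (V411 P k) (curlOp (P := P) w c) (QsE P k))
              (LinearMap.adjoint (curlOp (P := P) w c) (QesOp (P := P) hd w (k + 1) fL))),
         deltaOp (V411 P k) (curlOp (P := P) w c) (QsE P k)
           (B' + l • unitPropagator (V411 P k) (curlOp (P := P) w c) (QsE P k) (Wstep P k)
            (LinearMap.adjoint (Hop (V411 P k) (curlOp (P := P) w c) (QsE P k))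
              (LinearMap.adjoint (curlOp (P := P) w c) (QesOp (P := P) hd w (k + 1) fL))))⟫ := by
  rw [← scaling_absorbs hd hk hw hc hc' hl fL]
  exact eq611_torus_ax hd hk hc hw l fL B' hB'

/-- The same with the printed numbers: `l = L^{−d/2}`, `l² = L^{−d}`, the weight of the (k+1)-st step `L^{−d}·w`
(`= (η/L)^d` for `w = η^d`). [cite: BalabanImbrieJaffe1985, (6.1.1) p.319] -/
theorem eq611_torus_rescaled_L (hd : 2 ≤ P.d) {k : ℕ} (hk : k + 1 ≤ P.m + P.K) {c c' : ℝ} (hc : c ≠ 0) (hc' : c' ≠ 0) {w : ℝ}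
    (hw : 0 < w) (fL : UnitPlaqSpace P (k + 1)) (B' : CoarseSpace P k) (hB' : B' ∈ Wstep P k) :
    let l : ℝ := (Real.sqrt (P.L : ℝ))⁻¹ ^ P.d
    ⟪dOne P k c B' + l • QesOne P hd k fL, sigmaTorus (P := P) hd w c k (dOne P k c B' + l • QesOne P hd k fL)⟫ =
      ⟪fL, sigmaTorus (P := P) hd (((P.L : ℝ) ^ P.d)⁻¹ * w) c' (k + 1) fL⟫
      + ⟪B' + l • unitPropagator (V411 P k) (curlOp (P := P) w c) (QsE P k) (Wstep P k)
            (LinearMap.adjoint (Hop (V411 P k) (curlOp (P := P) w c) (QsE P k))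
              (LinearMap.adjoint (curlOp (P := P) w c) (QesOp (P := P) hd w (k + 1) fL))),
         deltaOp (V411 P k) (curlOp (P := P) w c) (QsE P k)
           (B' + l • unitPropagator (V411 P k) (curlOp (P := P) w c) (QsE P k) (Wstep P k)
            (LinearMap.adjoint (Hop (V411 P k) (curlOp (P := P) w c) (QsE P k))
              (LinearMap.adjoint (curlOp (P := P) w c) (QesOp (P := P) hd w (k + 1) fL))))⟫ := by
  intro l
  have hL : (0 : ℝ) < (P.L : ℝ) := by have := P.hL.2; positivity
  have hl0 : l ≠ 0 := pow_ne_zero _ (inv_ne_zero (Real.sqrt_pos.2 hL).ne')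
  have hl : l ^ 2 = ((P.L : ℝ) ^ P.d)⁻¹ := by
    show ((Real.sqrt (P.L : ℝ))⁻¹ ^ P.d) ^ 2 = _
    rw [← pow_mul, mul_comm, pow_mul, inv_pow, Real.sq_sqrt hL.le, inv_pow]
  rw [← hl]
  exact eq611_torus_rescaled hd hk hc hc' hw hl0 fL B' hB'

end

end Literature.MathematicalPhysics.QuantumFieldTheory.BalabanImbrieJaffe1984to88.BIJ85Eq611Torus
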